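import Mathlib
import Literature.NumberTheory.Automorphic.GaussCellGL

/-!
# Leading principal minors are multiplicative against a lower triangular left factor
— stub `stub_leadMinor_lower_mul` of line `Sketch` (crux `BorderHalfDimensionDesigns`,
stmt-MatrixMultiplication-18360, route `GLnSeparatingDesigns`)

For `m` lower triangular (`m i j = 0` for `i < j`, stated as
`m.BlockTriangular (fun i => toDual (Fin.castSucc i))`, definitionally
`m.BlockTriangular (toDual ∘ Fin.castSucc)`) and an arbitrary `M`, the leading block
`{castSucc < a} × {castSucc < a}` of `m * M` is the product of the leading blocks of `m` and `M`:
by `Matrix.toBlock_mul_eq_add` the only other contribution is through the block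
`m|_{castSucc < a, ¬ castSucc < a}`, which vanishes.  Taking determinants (`Matrix.det_mul`),
`Δ_a(m M) = Δ_a(m) Δ_a(M)` for the leading minors
`Δ_a = Literature.NumberTheory.Automorphic.leadMinor Fin.castSucc · a`.  This is the computation
`hblk` inside the proof of `Literature.NumberTheory.Automorphic.inv_eq_gaussS₁_of_eq_mul`
(`Literature/NumberTheory/Automorphic/GaussCellGL.lean`), isolated for the weight
`Fin.castSucc : Fin n → Fin (n + 1)` over `ℂ` and without any invertibility hypothesis.
-/

-- the mandated namespace repeats `MatrixMultiplication` (summit = sub-problem).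
set_option linter.dupNamespace false

open Matrix OrderDual
open Literature.NumberTheory.Automorphic (leadMinor leadBlock)

namespace Summit.MatrixMultiplication.MatrixMultiplication.Theorems.BorderHalfDimensionDesigns

/-- **Leading minors against a lower triangular left factor.** If `m` is lower triangular
(`m i j = 0` whenever `i < j`) then for every level `a : Fin (n + 1)` the leading principal minor
of `m * M` on the rows and columns `{i | Fin.castSucc i < a}` is the product of those of `m` and
of `M`: `Δ_a(m M) = Δ_a(m) · Δ_a(M)`.  (The leading block of `m * M` is
`m|_{<a} · M|_{<a}` because the block `m|_{<a, ≥ a}` is zero; then `det_mul`.) -/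
theorem stub_leadMinor_lower_mul {n : ℕ} (m M : Matrix (Fin n) (Fin n) ℂ)
    (hm : m.BlockTriangular (fun i : Fin n => OrderDual.toDual (Fin.castSucc i))) (a : Fin (n + 1)) :
    Literature.NumberTheory.Automorphic.leadMinor Fin.castSucc (m * M) a =
      Literature.NumberTheory.Automorphic.leadMinor Fin.castSucc m a *
        Literature.NumberTheory.Automorphic.leadMinor Fin.castSucc M a := by
  -- the block of `m` on rows `{castSucc < a}` and columns `{¬ castSucc < a}` vanishes
  have hzero : m.toBlock (fun i => Fin.castSucc i < a) (fun i => ¬Fin.castSucc i < a) = 0 := by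
    ext i j
    have hi : Fin.castSucc (i : Fin n) < a := i.2
    have hj : a ≤ Fin.castSucc (j : Fin n) := not_lt.mp j.2
    exact hm (toDual_lt_toDual.mpr (hi.trans_le hj))
  -- hence the leading block of the product is the product of the leading blocks
  have hblk : leadBlock Fin.castSucc (m * M) a =
      leadBlock Fin.castSucc m a * leadBlock Fin.castSucc M a := by
    unfold leadBlock
    rw [toBlock_mul_eq_add (fun i => Fin.castSucc i < a) (fun i => Fin.castSucc i < a)
      (fun i => Fin.castSucc i < a) m M, hzero, Matrix.zero_mul, add_zero]
  unfold leadMinor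
  rw [hblk, det_mul]

end Summit.MatrixMultiplication.MatrixMultiplication.Theorems.BorderHalfDimensionDesigns
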